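import Literature.NumberTheory.Rogawski1990.ArchSingularMembersPinRatio                    -- ★ p844053 (W4f): the (W-a) export shape read here
import Literature.NumberTheory.Weil1964.UnitaryArchSingularCentralizerRationalFrames        -- ★ `exists_isSingularArchFrame_cmRationalToArch`
import HarnessLib

/-!
# (W4g) THE RATIONAL-POINT JUNCTION: the (W-a) export of ★ (W4f) at `x = (γ_c)_∞ = γ₀ ⊗ 1` IS the `hK` binder of ★ (W6) `tamagawaSingularCovolume_transport_of_atPoint_eq_smul`
# (Rogawski 1990 §1.7, §3.8 Prop. 3.8.1 (a), §14.5 Lemma 14.5.2 (b))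

Topic `NumberTheory/Rogawski1990`; namespace `Literature.NumberTheory.Rogawski1990`.  THEOREMS ONLY (no `def`, no instance, no notation, no axiom, no named fact, no `sorry`).
Cell `pub/hodgecm-mathlib`, ENGINE T1 (crux H413 = `stmt-HodgeConjecture-24833`); the (ST-∞) witness road, brick (W4g) (F0P3-p03 (g11); LEAD F0P3a-plan (g10) WORD T9-22 (3);
F0P3a-p07 (g10) ★ p844052 (W6) KEYED LANDING 11:51:35Z: «your (W4f) (W-a) export at `x = cmRationalToArch (out c)` is EXACTLY this head's `hK`»).  Count-neutral; HONEST LABEL: HC_CM is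
proved only modulo the printed citations until rung 0 closes.

WHAT.  At a rational class `c` of `U(H′)(L⁺)` that is non-regular and NOT central (`out c ≠ ζ•1`), the archimedean component `(γ_c)_∞ = archPart (toAdelic (out c)) = out c ⊗ 1`
(★ `archPart_cmDatum_toAdelic`) (i) is in the S1′ guard (`out c ⊗ 1 ↔ out c ⊗ 1`), (ii) is not a rational scalar `ζ ⊗ 1` (entrywise injectivity of `mixedEmbedding`), and (iii) is FRAMED
(★ `exists_isSingularArchFrame_cmRationalToArch`: `out c` is semisimple since `U(H′)` is anisotropic, ★ `isSemisimpleElt_of_anisotropic`).  Hence: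
* **`atPoint_archPart_toAdelic_eq_smul_of_forall_guard`** — for ANY two archimedean families `m₁ m₂` and `K` with `m₁.atPoint x = K • m₂.atPoint x` at every framed guard point
  off the centre, ★ (W6)'s `hK` binder holds VERBATIM for `(m₁, m₂)`;
* **`atPoint_archPart_toAdelic_eq_smul_of_pinRatio_export`** — the same from the EXACT (W-a) conjunct of ★ (W4f) `exists_archSingularMembers_withData_of_universal_pinRatio`
  (`m₂ := archSingularTopFormFamily L H′ ν′`), so that the S1′ assembler composes ★ (W4f) → this → ★ (W6) by name: (K7-s) for the BUILT witness ⟸ (K7-s) for the top-form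
  witness + (U).

## References
* [Rogawski1990] J. D. Rogawski, *Automorphic Representations of Unitary Groups in Three Variables*, Ann. of Math. Stud. 123 (1990), §1.7 p. 6; §3.8 Prop. 3.8.1 (a) p. 27; §14.5
  Lemma 14.5.2 (b) pp. 238–239.
* [Kottwitz1988] R. E. Kottwitz, *Tamagawa numbers*, Ann. of Math. 127 (1988), Prop. 2.
* [BorelJacquet1979] A. Borel, H. Jacquet, *Automorphic forms and automorphic representations*, PSPM 33.1 (1979), §4.1.
-/

set_option autoImplicit false

noncomputable section

open MeasureTheory Measure NumberField NumberField.InfinitePlace NumberField.mixedEmbedding Set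
open Literature.MeasureTheory.Group Literature.NumberTheory.Automorphic
open Literature.NumberTheory.Automorphic.UnitaryGroup hiding hermForm
open Literature.AlgebraicGeometry.ShimuraVarieties (unitaryGroup hermForm)
open Literature.NumberTheory.Weil1964 Literature.NumberTheory.Weil1964.UnitaryArchTopForm
open scoped Matrix MatrixGroups NNReal ENNReal

namespace Literature.NumberTheory.Rogawski1990

variable (L : Type) [Field L] [NumberField L] [IsCMField L] (H' : Matrix (Fin 3) (Fin 3) L)

/-- **`γ₀ ⊗ 1` IS A RATIONAL SCALAR ONLY IF `γ₀` IS**: `(γ₀ ⊗ 1) = σ(ζ)•1` in `GL₃(L ⊗ ℝ)` forces `γ₀ = ζ•1` (the archimedean matrix is the entrywise image under the INJECTIVE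
`mixedEmbedding`; converse of ★ `coe_coe_cmRationalToArch_eq_smul_one_of_smul_one`). [cite: BorelJacquet1979, §4.1] -/
theorem smul_one_of_coe_coe_cmRationalToArch_eq_smul_one (γ₀ : (UnitaryGroup.cmDatum L 3 H').Rational) {ζ : L}
    (h : (((cmRationalToArch L 3 H' γ₀ : arch (↥(maximalRealSubfield L)) L (IsCMField.complexConj L) 3 H') : GL (Fin 3) (mixedSpace L)) : Matrix (Fin 3) (Fin 3) (mixedSpace L)) =
      mixedEmbedding L ζ • (1 : Matrix (Fin 3) (Fin 3) (mixedSpace L))) :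
    (((γ₀ : unitaryGroup (cmConjRingHom L) H').val : GL (Fin 3) L) : Matrix (Fin 3) (Fin 3) L) = ζ • (1 : Matrix (Fin 3) (Fin 3) L) := by
  have e : (((cmRationalToArch L 3 H' γ₀ : arch (↥(maximalRealSubfield L)) L (IsCMField.complexConj L) 3 H') : GL (Fin 3) (mixedSpace L)) : Matrix (Fin 3) (Fin 3) (mixedSpace L)) =
      ((((γ₀ : unitaryGroup (cmConjRingHom L) H').val : GL (Fin 3) L) : Matrix (Fin 3) (Fin 3) L)).map (mixedEmbedding L) := rfl
  have e1 : (ζ • (1 : Matrix (Fin 3) (Fin 3) L)).map (mixedEmbedding L) = mixedEmbedding L ζ • (1 : Matrix (Fin 3) (Fin 3) (mixedSpace L)) := by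
    rw [Matrix.map_smul' _ _ _ (map_mul (mixedEmbedding L)), Matrix.map_one (mixedEmbedding L) (map_zero _) (map_one _)]
  rw [e, ← e1] at h
  exact Matrix.map_injective (mixedEmbedding_injective L) h

variable
  [∀ γ : arch (↥(maximalRealSubfield L)) L (IsCMField.complexConj L) 3 H', MeasurableSpace (arch (↥(maximalRealSubfield L)) L (IsCMField.complexConj L) 3 H' ⧸ Subgroup.centralizer ({γ} : Set _))]

/-- **THE RATIONAL-POINT JUNCTION (generic in the two families).**  If `m₁.atPoint x = K • m₂.atPoint x` at every point `x ∈ U(H′)(L ⊗ ℝ)` of the S1′ guard («`∃ γ₀ ∈ U(H′)(L⁺)`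
non-regular, `γ₀ ⊗ 1 ↔ x`») that is not a rational scalar `ζ ⊗ 1` and is framed (the (W-a) export shape of ★ (W4f)), then at every non-regular NON-CENTRAL rational class `c`:
`m₁.atPoint (γ_c)_∞ = K • m₂.atPoint (γ_c)_∞` — ★ (W6) `tamagawaSingularCovolume_transport_of_atPoint_eq_smul`'s `hK` binder VERBATIM (`H′` hermitian anisotropic: `out c` is
semisimple, so `out c ⊗ 1` is framed by ★ `exists_isSingularArchFrame_cmRationalToArch`). [cite: Rogawski1990, §1.7 p. 6; §3.8 Prop. 3.8.1 (a) p. 27; §14.5 Lemma 14.5.2 (b) p. 239]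
[cite: Kottwitz1988, Prop. 2] -/
theorem atPoint_archPart_toAdelic_eq_smul_of_forall_guard (hherm : (H'.map (cmConjRingHom L))ᵀ = H')
    (hanis : ∀ x : Fin 3 → L, hermForm (cmConjRingHom L) H' x x = 0 → x = 0)
    {m₁ m₂ : OrbitalMeasureFamily (arch (↥(maximalRealSubfield L)) L (IsCMField.complexConj L) 3 H')} {K : ℝ≥0}
    (hWa : ∀ x : arch (↥(maximalRealSubfield L)) L (IsCMField.complexConj L) 3 H',
      (∃ γ₀ : (cmDatum L 3 H').Rational, ¬ IsRegularElt (γ₀.val : GL (Fin 3) L) ∧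
          Corresponds (conjMixed (↥(maximalRealSubfield L)) L (IsCMField.complexConj L)) (archFormOf L 3 H') (archFormOf L 3 H') (cmRationalToArch L 3 H' γ₀) x) →
      (¬ ∃ ζ : L, ((x : GL (Fin 3) (mixedSpace L)) : Matrix (Fin 3) (Fin 3) (mixedSpace L)) = mixedEmbedding L ζ • (1 : Matrix (Fin 3) (Fin 3) (mixedSpace L))) →
      (∃ (a b : L) (Tm : GL (Fin 3) (mixedSpace L)) (H_a : Matrix (Fin 2) (Fin 2) L) (H_b : Matrix (Fin 1) (Fin 1) L), IsSingularArchFrame L H' x a b Tm H_a H_b) →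
      m₁.atPoint x = K • m₂.atPoint x) :
    ∀ c : ConjClasses (UnitaryGroup.cmDatum L 3 H').Rational, ¬ IsRegularElt ((Quotient.out c).val : GL (Fin 3) L) →
      (¬ ∃ ζ : L, (((Quotient.out c).val : GL (Fin 3) L) : Matrix (Fin 3) (Fin 3) L) = ζ • (1 : Matrix (Fin 3) (Fin 3) L)) →
      m₁.atPoint (UnitaryGroup.archPart (↥(maximalRealSubfield L)) L (IsCMField.complexConj L) 3 H' ((UnitaryGroup.cmDatum L 3 H').toAdelic (Quotient.out c))) =
        K • m₂.atPoint (UnitaryGroup.archPart (↥(maximalRealSubfield L)) L (IsCMField.complexConj L) 3 H' ((UnitaryGroup.cmDatum L 3 H').toAdelic (Quotient.out c))) := by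
  intro c hnreg hnc
  have hdet : H'.det ≠ 0 := Godement.det_ne_zero_of_anisotropic L H' hanis
  rw [archPart_cmDatum_toAdelic]
  refine hWa _ ⟨Quotient.out c, hnreg, IsConj.refl _⟩ ?_ ?_
  · rintro ⟨ζ, hζ⟩
    exact hnc ⟨ζ, smul_one_of_coe_coe_cmRationalToArch_eq_smul_one L H' (Quotient.out c) hζ⟩
  · exact exists_isSingularArchFrame_cmRationalToArch hherm hdet (Quotient.out c) (isSemisimpleElt_of_anisotropic (cmConjRingHom L) H' hanis _) hnreg
      (fun ζ hζ => hnc ⟨ζ, hζ⟩)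

variable
  [MeasurableSpace (arch (↥(maximalRealSubfield L)) L (IsCMField.complexConj L) 3 H')] [BorelSpace (arch (↥(maximalRealSubfield L)) L (IsCMField.complexConj L) 3 H')]
  [∀ γ : arch (↥(maximalRealSubfield L)) L (IsCMField.complexConj L) 3 H', BorelSpace (arch (↥(maximalRealSubfield L)) L (IsCMField.complexConj L) 3 H' ⧸ Subgroup.centralizer ({γ} : Set _))]

/-- **THE RATIONAL-POINT JUNCTION FROM ★ (W4f)'s (W-a) CONJUNCT TOKEN FOR TOKEN** (`m₂ := archSingularTopFormFamily L H′ ν′`, the conjunct's `∃ _ _, … ∧ …` shape): ★ (W6)'s `hK` for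
`(mGis, archSingularTopFormFamily L H′ ν′)`. [cite: Rogawski1990, §1.7 p. 6; §3.8 Prop. 3.8.1 (a) p. 27; §14.5 Lemma 14.5.2 (b) p. 239] [cite: Kottwitz1988, Prop. 2] -/
theorem atPoint_archPart_toAdelic_eq_smul_of_pinRatio_export (hherm : (H'.map (cmConjRingHom L))ᵀ = H')
    (hanis : ∀ x : Fin 3 → L, hermForm (cmConjRingHom L) H' x x = 0 → x = 0)
    (ν' : Measure (arch (↥(maximalRealSubfield L)) L (IsCMField.complexConj L) 3 H')) [ν'.IsHaarMeasure] [ν'.IsMulRightInvariant]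
    {mGis : OrbitalMeasureFamily (arch (↥(maximalRealSubfield L)) L (IsCMField.complexConj L) 3 H')} {K : ℝ≥0}
    (hWa : ∀ x : arch (↥(maximalRealSubfield L)) L (IsCMField.complexConj L) 3 H',
      (∃ γ₀ : (cmDatum L 3 H').Rational, ¬ IsRegularElt (γ₀.val : GL (Fin 3) L) ∧
          Corresponds (conjMixed (↥(maximalRealSubfield L)) L (IsCMField.complexConj L)) (archFormOf L 3 H') (archFormOf L 3 H') (cmRationalToArch L 3 H' γ₀) x) →
      (¬ ∃ ζ : L, ((x : GL (Fin 3) (mixedSpace L)) : Matrix (Fin 3) (Fin 3) (mixedSpace L)) = mixedEmbedding L ζ • (1 : Matrix (Fin 3) (Fin 3) (mixedSpace L))) →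
      (∃ (a b : L) (Tm : GL (Fin 3) (mixedSpace L)) (H_a : Matrix (Fin 2) (Fin 2) L) (H_b : Matrix (Fin 1) (Fin 1) L), IsSingularArchFrame L H' x a b Tm H_a H_b) →
      ∃ (_ : (centralizerTopFormHaar L H' x).IsHaarMeasure) (_ : (centralizerTopFormHaar L H' x).IsInvInvariant),
        mGis.atPoint x = K • quotientMeasure (Subgroup.centralizer ({x} : Set (arch (↥(maximalRealSubfield L)) L (IsCMField.complexConj L) 3 H'))) (centralizerTopFormHaar L H' x) (isClosed_coe_centralizer_singleton x) ν' ∧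
        mGis.atPoint x = K • (archSingularTopFormFamily L H' ν').atPoint x) :
    ∀ c : ConjClasses (UnitaryGroup.cmDatum L 3 H').Rational, ¬ IsRegularElt ((Quotient.out c).val : GL (Fin 3) L) →
      (¬ ∃ ζ : L, (((Quotient.out c).val : GL (Fin 3) L) : Matrix (Fin 3) (Fin 3) L) = ζ • (1 : Matrix (Fin 3) (Fin 3) L)) →
      mGis.atPoint (UnitaryGroup.archPart (↥(maximalRealSubfield L)) L (IsCMField.complexConj L) 3 H' ((UnitaryGroup.cmDatum L 3 H').toAdelic (Quotient.out c))) =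
        K • (archSingularTopFormFamily L H' ν').atPoint (UnitaryGroup.archPart (↥(maximalRealSubfield L)) L (IsCMField.complexConj L) 3 H' ((UnitaryGroup.cmDatum L 3 H').toAdelic (Quotient.out c))) :=
  atPoint_archPart_toAdelic_eq_smul_of_forall_guard L H' hherm hanis fun x hx hnc hfr => by
    obtain ⟨-, -, -, h⟩ := hWa x hx hnc hfr
    exact h

end Literature.NumberTheory.Rogawski1990

end
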